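import Summits.AnomalousDissipation.AnomalousDissipation.Theorems.PumpedMirrorMirrorFloorTGStubSublevelCompactOn
import Summits.AnomalousDissipation.AnomalousDissipation.Theorems.PumpedMirrorMirrorFloorTGStubMinimaxAlternativeOn
import Summits.AnomalousDissipation.AnomalousDissipation.Theorems.PumpedMirrorMirrorFloorTGStubPenalisationLimitOn
import Summits.AnomalousDissipation.AnomalousDissipation.Theorems.PumpedMirrorMirrorFloorTGStubMirrorSlabClosed
import Summits.AnomalousDissipation.AnomalousDissipation.Theorems.PumpedMirrorMirrorFloorTGWeakDuality

/-!
# `PumpedMirror.MirrorFloorTG` (stmt-AnomalousDissipation-15372) — STRONG DUALITY ON THE MIRROR SLAB: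
# the crux is EQUIVALENT to its dual form "low-energy relaxed K-statistics of `f_TG` are loud"

Line `registered` (lead `prover-line-stmt-AnomalousDissipation-15372-c1-0`, 2026-08-17): the glue assembling the
four landed stubs S1a `stub_sublevelCompactOn`, S1b `stub_minimaxAlternativeOn`, S1c `stub_penalisationLimitOn`,
S2 `stub_mirrorSlabClosed` and the landed weak duality `mirrorLawsLoudTG_of_mirrorFloorTG` into

* `floorMinimaxOn` — STRONG DUALITY FOR FLOORS ON A CLOSED CARRIER INSIDE A BALL: for `ν > 0`, a level `ρ`, a
  floor `ε`, a smooth force `f` and a CLOSED `S ⊆ H`, if every relaxed stationary statistic of `NS_ν(f)` carried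
  by `S ∩ {|u|² ≤ ρ}` (probability measure, finite mean enstrophy, every cylindrical Liouville identity,
  integrable work, ONE global mean energy inequality) dissipates `≥ ε` in the mean, then for every margin `δ > 0`
  ONE cylindrical `Φ` and weight `θ ≤ 0` certify `ε − δ ≤ ν‖∇u‖² + ⟨F_ν(u),Φ'(u)⟩ + 2θ((u,f) − ν‖∇u‖²)` at every
  finite-enstrophy state of `S ∩ {|u|² ≤ ρ}` (minimax alternative at slope `n`, level `ε − δ/2`, slack `δ/4`;
  penalisation limit; contradiction) — the sibling `TaylorCertificatesFloorCertificateDuality.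
  floorFamily_of_relaxedFloor` with the Leray ball replaced by `S ∩ ball`;
* `mirrorFloorTG_of_mirrorLawsLoudTG` — S3 ⇒ the crux (closed mirror class S2, `f_TG` smooth, margin `ε₀/2`);
* `mirrorFloorTG_iff_mirrorLawsLoudTG` — THE CRUX ⟺ S3: `MirrorFloorTG` holds iff for every energy level `E > 0`
  there are `ε₀, ν₀ > 0` such that for `ν ∈ (0, ν₀)` every relaxed stationary K-statistic of `NS_ν(f_TG)` carried
  by `Fix K ∩ {|u|² ≤ E}` dissipates at least `ε₀`. The duality gap of the crux's certificate class on the mirror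
  slab is ZERO; the registered open stub `stub_mirrorLawsLoudTG` of the line is the crux's entire content.

References: Ky Fan, Minimax theorems, PNAS 39 (1953) Thm 2; Foias–Manley–Rosa–Temam 2001, Ch. IV §1.2; Rosa–Temam,
arXiv:2010.06730, Thm 6.2 and Rem. 6.1–6.2 (minimax for compact carriers / weak duality otherwise — here
compactness comes from the objective: enstrophy sublevel sets of slab-carried measures are tight);
Tobasco–Goluskin–Doering, Phys. Lett. A 382 (2018).
-/

noncomputable section

set_option linter.dupNamespace false

namespace Summit.AnomalousDissipation.AnomalousDissipation.Theorems.PumpedMirrorMirrorFloorTG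

open MeasureTheory Filter Topology UnitAddTorus
open scoped InnerProductSpace ENNReal NNReal
open Literature.Analysis.FunctionSpaces Literature.Analysis.FluidPDE
open Summit.AnomalousDissipation.AnomalousDissipation.Theses.PumpedMirror

/-! ## Strong duality on a closed carrier (S1a + S1b + S1c) -/

/-- **STRONG DUALITY FOR FLOORS ON A CLOSED CARRIER INSIDE A BALL.** For `ν > 0`, a level `ρ`, a floor `ε`,
a smooth force `f` and a closed `S ⊆ H`: if every relaxed stationary statistic of `NS_ν(f)` carried by
`S ∩ {|u|² ≤ ρ}` dissipates `≥ ε` in the mean, then for every `δ > 0` some cylindrical `Φ` and `θ ≤ 0` certify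
the floor `ε − δ` at every finite-enstrophy state of `S ∩ {|u|² ≤ ρ}`. Proof: otherwise the minimax alternative
(S1b, fed S1a) at slope `n`, level `ε − δ/2`, slack `δ/4` yields for every `n` an `(n, ε − δ/4)`-approximately
relaxed statistic on `S ∩ ball`, and the penalisation limit (S1c) an exact one dissipating `≤ ε − δ/4 < ε`.
[cite: FMRTTurbulence2001, Ch. IV §1.2; RosaTemam2020, Thm 6.2] -/
theorem floorMinimaxOn (ν ρ ε : ℝ) (f : UnitAddTorus (Fin 3) → EuclideanSpace ℝ (Fin 3))
    (S : Set (Torus.energySpace (Fin 3))) (hν : 0 < ν) (hfs : Torus.IsSmooth f) (hS : IsClosed S)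
    (hloud : ∀ μ : Measure (Torus.energySpace (Fin 3)), IsProbabilityMeasure μ →
      (∀ᵐ u ∂μ, ‖u‖ ^ 2 ≤ ρ) → (∀ᵐ u ∂μ, u ∈ S) → Torus.ensembleEnstrophy μ < ⊤ →
      (∀ Φ : Torus.CylindricalTest (Fin 3),
        Integrable (fun u => Torus.nsGeneratorPairing ν f u (Φ.grad u)) μ ∧
          ∫ u, Torus.nsGeneratorPairing ν f u (Φ.grad u) ∂μ = 0) →
      Integrable (fun u : Torus.energySpace (Fin 3) => Torus.pairing u.1 f) μ →
      Torus.ensembleDissipation ν μ ≤ ∫ u, Torus.pairing u.1 f ∂μ →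
      ε ≤ Torus.ensembleDissipation ν μ)
    (δ : ℝ) (hδ : 0 < δ) :
    ∃ (Φ : Torus.CylindricalTest (Fin 3)) (θ : ℝ), θ ≤ 0 ∧
      ∀ u : Torus.energySpace (Fin 3), u ∈ S →
        Torus.eGradNormSq (u.1 : UnitAddTorus (Fin 3) → EuclideanSpace ℝ (Fin 3)) ≠ ⊤ → ‖u‖ ^ 2 ≤ ρ →
        ε - δ ≤ ν * (Torus.eGradNormSq (u.1 : UnitAddTorus (Fin 3) → EuclideanSpace ℝ (Fin 3))).toReal +
          Torus.nsGeneratorPairing ν f u (Φ.grad u) +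
          2 * θ * (Torus.pairing u.1 f -
            ν * (Torus.eGradNormSq (u.1 : UnitAddTorus (Fin 3) → EuclideanSpace ℝ (Fin 3))).toReal) := by
  have hcpt := stub_sublevelCompactOn S hS
  have hMM := stub_minimaxAlternativeOn S hcpt ν ρ f hν hfs
  have hPL := stub_penalisationLimitOn S hcpt ν ρ f hν hfs (ε - δ / 2 + δ / 4)
  by_contra hno
  have hB := fun n : ℕ =>
    (hMM n (ε - δ / 2) (δ / 4) (Nat.cast_nonneg n) (by positivity)).resolve_left (by
      rintro ⟨Φ, θ, -, hθ0, -, hfloor⟩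
      refine hno ⟨Φ, θ, hθ0, fun u hu hfin hball => ?_⟩
      have h := hfloor u hu hfin hball
      linarith)
  choose μs hμs using hB
  obtain ⟨μ, ⟨hP, hball, hmem, hZ, hL, hI, hE⟩, hdiss⟩ := hPL μs hμs
  have := hloud μ hP hball hmem hZ hL hI hE
  linarith

/-! ## `f_TG` is smooth (its trigonometric-polynomial anatomy, self-contained) -/

/-- `f_TG` is the real trigonometric polynomial on the shell `{±1}³` with coefficients
`(1/8)(−i k₀, i k₁, 0)` (MirrorVariety `Negative/Anatomy`; the route's `closes`, verbatim). -/
theorem tgLambda_eq_realTrigPoly :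
    (fun x : UnitAddTorus (Fin 3) => !₂[(fourier 1 (x 0) : ℂ).im * (fourier 1 (x 1) : ℂ).re * (fourier 1 (x 2) : ℂ).re,
      -((fourier 1 (x 0) : ℂ).re * (fourier 1 (x 1) : ℂ).im * (fourier 1 (x 2) : ℂ).re), (0 : ℝ)]) =
      Torus.realTrigPoly (Fintype.piFinset fun _ : Fin 3 => ({1, -1} : Finset ℤ))
      (fun k => ((8⁻¹ : ℝ) : ℂ) • !₂[-(Complex.I * (k 0 : ℂ)), Complex.I * (k 1 : ℂ), 0]) := by
  set fTG : UnitAddTorus (Fin 3) → EuclideanSpace ℝ (Fin 3) :=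
    (fun x : UnitAddTorus (Fin 3) => !₂[(fourier 1 (x 0) : ℂ).im * (fourier 1 (x 1) : ℂ).re * (fourier 1 (x 2) : ℂ).re,
        -((fourier 1 (x 0) : ℂ).re * (fourier 1 (x 1) : ℂ).im * (fourier 1 (x 2) : ℂ).re), (0 : ℝ)]) with hfTG'
  have hfTG : fTG = fun x => !₂[(fourier 1 (x 0) : ℂ).im * (fourier 1 (x 1) : ℂ).re * (fourier 1 (x 2) : ℂ).re,
      -((fourier 1 (x 0) : ℂ).re * (fourier 1 (x 1) : ℂ).im * (fourier 1 (x 2) : ℂ).re), (0 : ℝ)] := rfl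
  set S : Finset (Fin 3 → ℤ) := Fintype.piFinset fun _ : Fin 3 => ({1, -1} : Finset ℤ) with hS
  set C : (Fin 3 → ℤ) → EuclideanSpace ℂ (Fin 3) :=
    fun k => ((8⁻¹ : ℝ) : ℂ) • !₂[-(Complex.I * (k 0 : ℂ)), Complex.I * (k 1 : ℂ), 0] with hC
  have hsp : ∀ g : Fin 3 → ℤ → ℂ, ∑ k ∈ S, ∏ j, g j (k j) = ∏ j, (g j 1 + g j (-1)) := by
    intro g
    rw [hS, ← Finset.prod_univ_sum]
    exact Finset.prod_congr rfl fun j _ => Finset.sum_pair (by decide)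
  have hmF3 : ∀ (k : Fin 3 → ℤ) (x : UnitAddTorus (Fin 3)),
      UnitAddTorus.mFourier k x = fourier (k 0) (x 0) * fourier (k 1) (x 1) * fourier (k 2) (x 2) := by
    intro k x; simp [UnitAddTorus.mFourier, Fin.prod_univ_three]
  have ha0 : ∀ x : UnitAddTorus (Fin 3), (∑ k ∈ S, UnitAddTorus.mFourier k x * C k 0).re = fTG x 0 := by
    intro x
    have h : ∀ k ∈ S, UnitAddTorus.mFourier k x * C k 0 =
        ∏ j, (![fun a : ℤ => fourier a (x 0) * (((8⁻¹ : ℝ) : ℂ) * -(Complex.I * (a : ℂ))),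
          fun a : ℤ => (fourier a (x 1) : ℂ), fun a : ℤ => (fourier a (x 2) : ℂ)] : Fin 3 → ℤ → ℂ) j (k j) := by
      intro k _
      rw [hmF3, Fin.prod_univ_three]
      simp [hC]
      ring
    rw [Finset.sum_congr rfl h, hsp, Fin.prod_univ_three]
    simp only [Matrix.cons_val_zero, Matrix.cons_val_one, Matrix.cons_val_two, Matrix.head_cons, Matrix.tail_cons,
      fourier_neg, Int.cast_one, Int.cast_neg, hfTG, PiLp.toLp_apply]
    simp only [Complex.mul_re, Complex.mul_im, Complex.add_re, Complex.add_im, Complex.neg_re, Complex.neg_im,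
      Complex.conj_re, Complex.conj_im, Complex.I_re, Complex.I_im, Complex.ofReal_re, Complex.ofReal_im,
      Complex.one_re, Complex.one_im, zero_mul, sub_zero, zero_sub, add_zero, zero_add, mul_one, one_mul]
    ring
  have ha1 : ∀ x : UnitAddTorus (Fin 3), (∑ k ∈ S, UnitAddTorus.mFourier k x * C k 1).re = fTG x 1 := by
    intro x
    have h : ∀ k ∈ S, UnitAddTorus.mFourier k x * C k 1 =
        ∏ j, (![fun a : ℤ => (fourier a (x 0) : ℂ),
          fun a : ℤ => fourier a (x 1) * (((8⁻¹ : ℝ) : ℂ) * (Complex.I * (a : ℂ))),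
          fun a : ℤ => (fourier a (x 2) : ℂ)] : Fin 3 → ℤ → ℂ) j (k j) := by
      intro k _
      rw [hmF3, Fin.prod_univ_three]
      simp [hC]
      ring
    rw [Finset.sum_congr rfl h, hsp, Fin.prod_univ_three]
    simp only [Matrix.cons_val_zero, Matrix.cons_val_one, Matrix.cons_val_two, Matrix.head_cons, Matrix.tail_cons,
      fourier_neg, Int.cast_one, Int.cast_neg, hfTG, PiLp.toLp_apply]
    simp only [Complex.mul_re, Complex.mul_im, Complex.add_re, Complex.add_im, Complex.neg_re, Complex.neg_im,
      Complex.conj_re, Complex.conj_im, Complex.I_re, Complex.I_im, Complex.ofReal_re, Complex.ofReal_im,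
      Complex.one_re, Complex.one_im, zero_mul, sub_zero, zero_sub, add_zero, zero_add, mul_one, one_mul]
    ring
  have ha2 : ∀ x : UnitAddTorus (Fin 3), (∑ k ∈ S, UnitAddTorus.mFourier k x * C k 2).re = fTG x 2 :=
    fun x => by simp [hC, hfTG]
  funext x
  ext i
  rw [Torus.realTrigPoly_apply_coord, Torus.trigPoly_apply_coord]
  fin_cases i
  · exact (ha0 x).symm
  · exact (ha1 x).symm
  · exact (ha2 x).symm

/-- `f_TG` (the crux's lambda term) is smooth: a real trigonometric polynomial. -/
theorem isSmooth_tgLambda :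
    Torus.IsSmooth (fun x : UnitAddTorus (Fin 3) => !₂[(fourier 1 (x 0) : ℂ).im * (fourier 1 (x 1) : ℂ).re * (fourier 1 (x 2) : ℂ).re,
      -((fourier 1 (x 0) : ℂ).re * (fourier 1 (x 1) : ℂ).im * (fourier 1 (x 2) : ℂ).re), (0 : ℝ)]) :=
  tgLambda_eq_realTrigPoly ▸ Torus.isSmooth_realTrigPoly _ _


/-! ## The crux from its dual form, and the equivalence -/

/-- **S3 ⇒ `MirrorFloorTG`.** Given `E > 0`, S3 supplies `(ε₀, ν₀)` such that every relaxed stationary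
K-statistic of `NS_ν(f_TG)` below energy `E` dissipates `≥ ε₀` for `ν ∈ (0, ν₀)`; strong duality on the closed
mirror class (`floorMinimaxOn`, fed S2 `stub_mirrorSlabClosed` and the smoothness of `f_TG`) with margin
`δ = ε₀/2` hands over `(Φ, θ ≤ 0)` certifying `ε₀/2` at every finite-enstrophy mirror state below energy `E` —
verbatim the crux at level `E` with the answer `(ε₀/2, ν₀)`. [cite: RosaTemam2020, Thm 6.2 and Rem. 6.1–6.2] -/
theorem mirrorFloorTG_of_mirrorLawsLoudTG
    (hloud : ∀ f : UnitAddTorus (Fin 3) → EuclideanSpace ℝ (Fin 3),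
      f = (fun x => !₂[(fourier 1 (x 0) : ℂ).im * (fourier 1 (x 1) : ℂ).re * (fourier 1 (x 2) : ℂ).re,
        -((fourier 1 (x 0) : ℂ).re * (fourier 1 (x 1) : ℂ).im * (fourier 1 (x 2) : ℂ).re), (0 : ℝ)]) →
    ∀ E : ℝ, 0 < E → ∃ ε₀ ν₀ : ℝ, 0 < ε₀ ∧ 0 < ν₀ ∧ ∀ ν : ℝ, 0 < ν → ν < ν₀ →
      ∀ μ : Measure (Torus.energySpace (Fin 3)), IsProbabilityMeasure μ →
        (∀ᵐ u ∂μ, ∀ i j : Fin 3,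
          (fun x => (u.1 : UnitAddTorus (Fin 3) → EuclideanSpace ℝ (Fin 3)) (Function.update x i (-x i)) j)
            =ᵐ[volume]
          (fun x => if j = i then -((u.1 : UnitAddTorus (Fin 3) → EuclideanSpace ℝ (Fin 3)) x j)
            else (u.1 : UnitAddTorus (Fin 3) → EuclideanSpace ℝ (Fin 3)) x j)) →
        (∀ᵐ u ∂μ, ‖u‖ ^ 2 ≤ E) →
        Torus.ensembleEnstrophy μ < ⊤ →
        (∀ Φ : Torus.CylindricalTest (Fin 3),
          Integrable (fun u => Torus.nsGeneratorPairing ν f u (Φ.grad u)) μ ∧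
            ∫ u, Torus.nsGeneratorPairing ν f u (Φ.grad u) ∂μ = 0) →
        Integrable (fun u : Torus.energySpace (Fin 3) => Torus.pairing u.1 f) μ →
        Torus.ensembleDissipation ν μ ≤ ∫ u, Torus.pairing u.1 f ∂μ →
        ε₀ ≤ Torus.ensembleDissipation ν μ) :
    MirrorFloorTG := by
  intro f hf E hE
  obtain ⟨ε₀, ν₀, hε₀, hν₀, hL⟩ := hloud f hf E hE
  refine ⟨ε₀ / 2, ν₀, half_pos hε₀, hν₀, fun ν hν hνlt => ?_⟩
  have hfs : Torus.IsSmooth f := hf ▸ isSmooth_tgLambda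
  obtain ⟨Φ, θ, hθ, hfloor⟩ := floorMinimaxOn ν E ε₀ f _ hν hfs stub_mirrorSlabClosed
    (fun μ hP hball hmem hZ hLi hW hEI => hL ν hν hνlt μ hP hmem hball hZ hLi hW hEI) (ε₀ / 2) (half_pos hε₀)
  refine ⟨Φ, θ, hθ, fun u hu hfin hball => ?_⟩
  have h := hfloor u hu hfin hball
  linarith

/-- **THE CRUX ⟺ ITS DUAL FORM** (weak + strong duality on the mirror slab; duality gap zero): `MirrorFloorTG`
holds iff for every energy level `E > 0` there are `ε₀, ν₀ > 0` such that for `ν ∈ (0, ν₀)` every relaxed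
stationary K-statistic of `NS_ν(f_TG)` — Borel probability measure on `H` carried by `Fix K ∩ {|u|² ≤ E}`, finite
mean enstrophy, every cylindrical Liouville identity, integrable work, `ν∫‖∇u‖²dμ ≤ ∫(u,f_TG)dμ` — dissipates
at least `ε₀` in the mean. The right-hand side is the registered open stub `stub_mirrorLawsLoudTG` of line
`registered`, verbatim: the crux's entire remaining content. [cite: RosaTemam2020, Thm 6.2–6.4] -/
theorem mirrorFloorTG_iff_mirrorLawsLoudTG :
    Summit.AnomalousDissipation.AnomalousDissipation.Theses.PumpedMirror.MirrorFloorTG ↔ ∀ f : UnitAddTorus (Fin 3) → EuclideanSpace ℝ (Fin 3),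
      f = (fun x => !₂[(fourier 1 (x 0) : ℂ).im * (fourier 1 (x 1) : ℂ).re * (fourier 1 (x 2) : ℂ).re,
        -((fourier 1 (x 0) : ℂ).re * (fourier 1 (x 1) : ℂ).im * (fourier 1 (x 2) : ℂ).re), (0 : ℝ)]) →
    ∀ E : ℝ, 0 < E → ∃ ε₀ ν₀ : ℝ, 0 < ε₀ ∧ 0 < ν₀ ∧ ∀ ν : ℝ, 0 < ν → ν < ν₀ →
      ∀ μ : Measure (Torus.energySpace (Fin 3)), IsProbabilityMeasure μ →
        (∀ᵐ u ∂μ, ∀ i j : Fin 3,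
          (fun x => (u.1 : UnitAddTorus (Fin 3) → EuclideanSpace ℝ (Fin 3)) (Function.update x i (-x i)) j)
            =ᵐ[volume]
          (fun x => if j = i then -((u.1 : UnitAddTorus (Fin 3) → EuclideanSpace ℝ (Fin 3)) x j)
            else (u.1 : UnitAddTorus (Fin 3) → EuclideanSpace ℝ (Fin 3)) x j)) →
        (∀ᵐ u ∂μ, ‖u‖ ^ 2 ≤ E) →
        Torus.ensembleEnstrophy μ < ⊤ →
        (∀ Φ : Torus.CylindricalTest (Fin 3),
          Integrable (fun u => Torus.nsGeneratorPairing ν f u (Φ.grad u)) μ ∧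
            ∫ u, Torus.nsGeneratorPairing ν f u (Φ.grad u) ∂μ = 0) →
        Integrable (fun u : Torus.energySpace (Fin 3) => Torus.pairing u.1 f) μ →
        Torus.ensembleDissipation ν μ ≤ ∫ u, Torus.pairing u.1 f ∂μ →
        ε₀ ≤ Torus.ensembleDissipation ν μ :=
  ⟨mirrorLawsLoudTG_of_mirrorFloorTG, mirrorFloorTG_of_mirrorLawsLoudTG⟩

end Summit.AnomalousDissipation.AnomalousDissipation.Theorems.PumpedMirrorMirrorFloorTG

end
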